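import Mathlib
import Summits.MatrixMultiplication.MatrixMultiplication.Theses.FourierTwoFamiliesModP
import Summits.MatrixMultiplication.MatrixMultiplication.Theorems.FourierTwoFamiliesModPPrimeTwoFamiliesStubHonestOfSelfConverse
import Summits.MatrixMultiplication.MatrixMultiplication.Theorems.FourierTwoFamiliesModPPrimeTwoFamiliesLadderEquivalence
import Summits.MatrixMultiplication.MatrixMultiplication.Theorems.FourierTwoFamiliesModPPrimeTwoFamiliesStubGadgetsOfCrux

/-!
# Self-converse gadgets `↔ PrimeTwoFamilies`, assembled through honest sub-families and ladders

Crux `stmt-MatrixMultiplication-14308` (`FourierTwoFamiliesModP.PrimeTwoFamilies`, CKSU 2005 Conj. 4.7 with prime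
cyclic hosts), line `Sketch`, registered stub `selfConverseGadgets_iff_primeTwoFamilies` (signature verbatim,
gadget / SDPP clauses inlined, no new definitions).

A *self-converse gadget* of slice `ε` in `ℤ/m` is a list of `r ≥ m^{1-ε}` direct pairs `(P c, Q c)_{c<r}` of
co-volume `|P c| |Q c| ≥ m^{1-ε}` with a map `π : Fin r → Fin r` such that every ordered pair of distinct letters
`σ ≠ τ` is strongly separated — every cross difference `q - p` (`p ∈ P σ`, `q ∈ Q τ`) avoids every diagonal
difference `q' - p'` (`p' ∈ P c`, `q' ∈ Q c`) — either directly or after applying `π`.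

This file assembles the equivalence with the crux from LANDED lemmas of the crux only, along the chain

  self-converse gadgets ⟹ honest SDPP families in the same `ℤ/m` near the apex
      (`CapacityLift.stub_honestOfSelfConverse`: letters through a popular point, pushed through `π`)
    ⟹ ordered escape ladders in `ℤ/m` (an honest family is a ladder in ANY order: clause (X) at `(p, c, q)`)
    ⟹ `PrimeTwoFamilies` (`LadderLift.primeTwoFamilies_iff_cyclicLadder`: constant-sum lift, carry-free
      transfer into a Bertrand prime, exponent bookkeeping),

and back by letter repetition (`CapacityLift.stub_gadgetsOfCrux`).  This is a second, independent assembly of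
the same equivalence (the capacity-code route goes through graph-word codes and the code lift instead); the
only new mathematics here is the one-line remark that (W) ∧ (X) families are ladders.
-/

-- single-conjunct summit: the mandated namespace repeats `MatrixMultiplication` (summit = sub-problem).
set_option linter.dupNamespace false

namespace Summit.MatrixMultiplication.MatrixMultiplication.Theorems.PrimeTwoFamilies.HonestLadder

open Finset
open Summit.MatrixMultiplication.MatrixMultiplication.Theses
open Summit.MatrixMultiplication.MatrixMultiplication.Theorems.PrimeTwoFamilies

/-- **An honest SDPP family is an ordered escape ladder** (in any order of its classes): if `(A i, B i)_{i<n}`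
satisfies clause (X) — `a ∈ A i`, `a' ∈ A j`, `b ∈ B j`, `b' ∈ B k`, `(a - a') + (b - b') = 0 ⟹ i = k` —
then for classes `p < q` every lower cross difference `y' - x'` (`x' ∈ A p`, `y' ∈ B q`) differs from every
diagonal difference `y - x` (`x ∈ A c`, `y ∈ B c`): an equality is clause (X) at `(p, c, q)`, forcing `p = q`. -/
theorem ladder_of_honest {K : Type*} [AddCommGroup K] {n : ℕ} (A B : Fin n → Finset K)
    (hX : ∀ i j k : Fin n, ∀ a ∈ A i, ∀ a' ∈ A j, ∀ b ∈ B j, ∀ b' ∈ B k,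
      (a - a') + (b - b') = 0 → i = k) :
    ∀ c p q : Fin n, p < q → ∀ x ∈ A c, ∀ y ∈ B c, ∀ x' ∈ A p, ∀ y' ∈ B q, y - x ≠ y' - x' := by
  intro c p q hpq x hx y hy x' hx' y' hy' heq
  have h0 : (x' - x) + (y - y') = 0 := by
    rw [show (x' - x) + (y - y') = (y - x) - (y' - x') by abel, heq, sub_self]
  exact absurd (hX p c q x' hx' x hx y hy y' hy' h0) (ne_of_lt hpq)

/-- **Self-converse gadgets `↔ PrimeTwoFamilies`** (registered stub `selfConverseGadgets_iff_primeTwoFamilies`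
of crux stmt-MatrixMultiplication-14308, line `Sketch`; the `L = 2` form of the capacity line is equivalent to —
not stronger than — the crux).  (⇒) A self-converse gadget family contains, in the same `ℤ/m`, an honest SDPP
family with `n ≥ m^{1/2-ε}` pairs of co-volume `≥ m^{1-ε}` (`CapacityLift.stub_honestOfSelfConverse`); an
honest family is a ladder in any order (`ladder_of_honest`); ladders near the apex give the crux
(`LadderLift.primeTwoFamilies_iff_cyclicLadder`).  (⇐) Letter repetition (`CapacityLift.stub_gadgetsOfCrux`). -/
theorem selfConverseGadgets_iff_primeTwoFamilies
    : (∀ ε : ℝ, 0 < ε → ∀ m₀ : ℕ, ∃ m ≥ m₀, ∃ r : ℕ, ∃ P Q : Fin r → Finset (ZMod m), ∃ π : Fin r → Fin r, (∀ c : Fin r, ∀ x ∈ P c, ∀ x' ∈ P c, ∀ y ∈ Q c, ∀ y' ∈ Q c, (x - x') + (y - y') = 0 → x = x' ∧ y = y') ∧ (∀ σ τ : Fin r, σ ≠ τ → (∀ p ∈ P σ, ∀ q ∈ Q τ, ∀ c : Fin r, ∀ p' ∈ P c, ∀ q' ∈ Q c, q - p ≠ q' - p') ∨ (∀ p ∈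 P (π σ), ∀ q ∈ Q (π τ), ∀ c : Fin r, ∀ p' ∈ P c, ∀ q' ∈ Q c, q - p ≠ q' - p')) ∧ (m : ℝ) ^ (1 - ε) ≤ (r : ℝ) ∧ ∀ c : Fin r, (m : ℝ) ^ (1 - ε) ≤ (((P c).card * (Q c).card : ℕ) : ℝ)) ↔ FourierTwoFamiliesModP.PrimeTwoFamilies := by
  refine ⟨fun h => ?_, fun hT => CapacityLift.stub_gadgetsOfCrux hT⟩
  -- honest sub-families through a popular point, in the same `ℤ/m`
  have hH := CapacityLift.stub_honestOfSelfConverse h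
  -- honest families are ladders; ladders near the apex give the crux
  refine LadderLift.primeTwoFamilies_iff_cyclicLadder.2 fun ε hε m₀ => ?_
  obtain ⟨m, hm, n, A, B, hW, hX, hn, hcov⟩ := hH ε hε m₀
  exact ⟨m, hm, n, A, B, ⟨hW, ladder_of_honest A B hX⟩, hn, hcov⟩

end Summit.MatrixMultiplication.MatrixMultiplication.Theorems.PrimeTwoFamilies.HonestLadder
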